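import Literature.MathematicalPhysics.QuantumFieldTheory.Balaban1983to89.B7Prop5CplxLinear
import Literature.MathematicalPhysics.QuantumFieldTheory.Balaban1983to89.B7Prop5GeneralInduction

/-!
# `Balaban1983to89.B7Prop5CplxInduction` — T. Bałaban, *Averaging operations for lattice gauge theories*, Commun. Math. Phys.
**98** (1985) 17–51 [Balaban1985Averaging]: Proposition 5 EXTENDED TO THE COMPLEX BACKGROUND `U′U₀` (p. 43 «Similarly,
Proposition 5 may be extended … The formulations are obvious.») — file 3/5: the induction (149)–(155) for the functional
derivative of the remainders `C_j(W, ·)`, PER BOND, with LEVEL-DEPENDENT one-step inputs; (157) and (156) k-uniform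

statement-level skeleton of published theorems with citation tags; proofs where landed; nothing here is a claim about the Yang–Mills mass gap

PDF held: `paper:balaban1985-cmp98-averaging` (journal page = PDF page + 16); pp. 40–42 [PDF 24–26] ((148)–(157)) and p. 43
[PDF 27] read from the materialised text layer `~/.lit/texts/paper-balaban1985-cmp98-averaging/p0024.txt`–`p0027.txt`.

CITATION HEADER / WHAT IS REPRODUCED.  SKELETON row **B7.Prop7** (cell `lit-balaban`, HOME `run/shared/lean/pub/lit-balaban/`,
seat p06 gen 4 = unit `lit-balaban-p06`; B7 owner r04, referee ref-4), located qualifier of ROWS-B7 v3.7 «the Prop. 5 extension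
… not typed»; companion rows B7.Prop5 / B7.Eq149 (proved @gen for `U₀` by `B7Prop5GeneralInduction` + `B7Prop5General`).
pp. 40–42, verbatim: *"We will prove by induction that |⟨(δ/δA)C_j(U₀, A), δA⟩| ≦ C₃|A|Q″_j|δA|, (149) … C_{j+1}(U₀, A) =
LQ(Ū₀ʲ)C_j(U₀, L^{−1}A) + C(Ū₀ʲ, L^{−1}Q_j(U₀)A + C_j(U₀, L^{−1}A)), (152) … Differentiation of the above equality gives (153)
Using (143), (148), (149) we obtain the following bound: (154) This bound implies the inequality (149) for j + 1 if
4dC′₁α₀L^{−1} + (C″₁/C₃)(1 + 4dC′₁α₀L^{−2} + C₂L^{−1}α₁ + 2dC₃L^{−1}α₁)² ≦ 1. (155) This inequality is satisfied if C₃ > C″₁ and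
α₀, α₁ are sufficiently small … Proposition 5. … |(δ/δA_b)Q_k(U₀, ηA, c)| ≦ 1 + 2C′₁α₀ + C₃|A| (156) |(δ/δA_b)C_k(U₀, A, c)| ≦
C₃|A| (157)"*; p. 43: *"Similarly, Proposition 5 may be extended to include analyticity and uniformity statements. The
formulations are obvious."*

THE PRINTED ROUTE, FOLLOWED — AND WHY A NEW FILE.  `B7Prop5GeneralInduction.ineq149` runs (149)–(155) per bond at a general
unit-valued background from the displayed one-step inputs at the level backgrounds, with the (139)/(143) level weight
`θ·(Lʲ/Lᵏ)²` HARD-WIRED.  At `W = U′U₀` the one-step majorant (139) at `Ũ′ʲŪ₀ʲ` is three-term with level sequences `ε_j`, `τ_j`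
and (143) carries a cumulative `Θ_j` (file 2 `B7Prop5CplxLinear`); this file re-runs (153)–(154) with those: the term
`Q(W̄ʲ)⟨δC_j/δA, δA⟩` is majorised by `(1+ε_j)Q|·| + τ_jQ″|·|` (139)ⱼ, the inner variation by (143)ⱼ with `Θ_j` and by
(149)ⱼ, the `C(W̄ʲ, ·)` term by (148) at `W̄ʲ` (hypothesis `h148`, constant `C″`), and the bound closes for `j + 1` under
  `(1 + ε_j)(2L − 1) + 2d·τ_j·L + (2C″/C₃)·(1 + 2d·Θ_j + 2d·C₃·Lᵏb) ≤ L²`                               (155)ⱼ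
(print's (155) line by line in the un-normalised per-bond currency: `4dC′₁α₀L^{−1} ↦ (2L−1)L^{−2}·ε-excess + 2dτ_jL^{−1}`,
`C″₁/C₃(…)² ↦ 2C″/C₃(1 + 2dΘ_j + 2dC₃Lᵏb)L^{−2}` with (131)'s factor `2` for the size of the argument, as in
`B7Prop5GeneralInduction`).  `B7Prop5GeneralInduction.ineq149` is the case `ε_j = 0`, `τ_j = Θ_j = θ(Lʲ/Lᵏ)²` (its `h155`).

DICTIONARY: as in `B7Prop5GeneralInduction` (REUSED BY NAME: `CCovIter` = `C_j(W, ·)` (150), `dCov` = the differential (137) in a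
single-bond direction, `CCovIter_zero`, `CCovIter_succ` = (152)); the background `W : Site d → Fin d → 𝔸ˣ` is any unit-valued
configuration, the level backgrounds `avgIter L W j` (`= Ũ′ʲŪ₀ʲ` at `W = e^{B′}U₀`).  Hypotheses = the displayed one-step inputs
at the level backgrounds, `j < k`: `hadd`/`hsmul` (linearity of `L(Q(W̄ʲ)·)_c`), `h139` (three-term (139)ⱼ), `hstep143`
((145)ⱼ of file 2), `hloc` (locality of `C(W̄ʲ, ·)(c)`), `h148`/`hdiff` ((148) on the box variables `𝔸^{S1}`, radius `ρ`,
constant `C″`), `h131` («|Q_j(U′U₀, ηA)| ≦ 2Lʲηα₁», Prop. 7's (131)), `hρ` (`2Lʲb < ρ`), `hstep149` ((155)ⱼ).  They are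
DISCHARGED at `W = e^{B′}U₀` in files 4–5 (`B7Prop5CplxLevels`, `B7Prop5Cplx`).

WHAT THIS FILE PROVES (kernel, 0 sorry, theorems only), for `L ≥ 2`: `ineq155_cplx_arith` (monotonicity `Lʲb ≤ Lᵏb` in
(155)ⱼ); **`ineq149_cplx`** = (149) per bond for every `j ≤ k`: differentiability of `t ↦ C_j(B + tXδ_b)(c)` at `0` and
`‖dC_j(B; Xδ_b)(c)‖ ≤ C₃(Lʲ)²b·kerQdd(c, b)·‖X‖`; **`prop5_cplx_157`** (uniform form `≤ C₃(Lʲ)²L^{−jd}b‖X‖` + locality «zero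
unless b ⊂ Bʲ(c₋) ∪ Bʲ(c₊)»); **`prop5_cplx_156`** ((156) with «1 + 2C′₁α₀ ↦ 1 + Θ_j»: the derivative of `Q_j(W, ηA)(c)` itself,
`≤ ((1 + Θ_j)Lʲ + C₃(Lʲ)²b)·L^{−jd}‖X‖`).
DIVERGENCES from print: as in `B7Prop5GeneralInduction` (per-bond bookkeeping, sharp `2 − L⁻¹`, (131)'s factor `2` for the
`C₂L^{−1}α₁` refinement); the step conditions are displayed hypotheses on the sequences.
-/

noncomputable section

open scoped BigOperators
open Finset

namespace Literature.MathematicalPhysics.QuantumFieldTheory.Balaban1983to89.B7Prop5CplxInduction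

open B7Prop1Explicit B7Prop1Local B7Prop2Explicit B7Prop3Flat B7Prop4Flat B7Prop5Flat B7Eq92Concrete
  B7Prop3GeneralLinear B7Prop4GeneralLevels B7Ineq148 B7Prop5GeneralOperators B7Prop5GeneralOperatorFacts
  B7Prop5GeneralLinear B7Prop5GeneralInduction B7Prop5CplxLinear

export B7Prop1Explicit (Site)

variable {d : ℕ} {𝔸 : Type*} [NormedRing 𝔸] [NormedAlgebra ℂ 𝔸] [CompleteSpace 𝔸]

/-! ## §1 The closing arithmetic (155) with level-dependent inputs -/

/-- the closing arithmetic of (154)–(155) with level-dependent one-step inputs: (155)ⱼ is stated with the largest field size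
`Lᵏb`; for `t ≤ T` it gives `(1+ε)(2L−1) + 2dτL + (2C″/C₃)(1 + 2dΘ + 2dC₃t) ≤ L²`. [cite: Balaban1985Averaging, (154)–(155) p.41] -/
theorem ineq155_cplx_arith {L d ε τ Θ C'' C₃ t T : ℝ} (hd : 0 ≤ d) (hC'' : 0 ≤ C'') (hC₃ : 0 < C₃) (htT : t ≤ T)
    (h155 : (1 + ε) * (2 * L - 1) + 2 * d * τ * L + 2 * C'' / C₃ * (1 + 2 * d * Θ + 2 * d * C₃ * T) ≤ L ^ 2) :
    (1 + ε) * (2 * L - 1) + 2 * d * τ * L + 2 * C'' / C₃ * (1 + 2 * d * Θ + 2 * d * C₃ * t) ≤ L ^ 2 := by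
  have hq : 0 ≤ 2 * C'' / C₃ := by positivity
  have h3 : 2 * d * C₃ * t ≤ 2 * d * C₃ * T := mul_le_mul_of_nonneg_left htT (by positivity)
  have h4 : 2 * C'' / C₃ * (1 + 2 * d * Θ + 2 * d * C₃ * t) ≤ 2 * C'' / C₃ * (1 + 2 * d * Θ + 2 * d * C₃ * T) :=
    mul_le_mul_of_nonneg_left (by linarith) hq
  linarith

/-! ## §2 The (149) induction per bond with level-dependent inputs -/

section Levels

variable (L : ℕ) (hL : 2 ≤ L) (W : Site d → Fin d → 𝔸ˣ) (k : ℕ) {ε τ Θ : ℕ → ℝ} {C'' C₃ ρ b : ℝ}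
  (hε : ∀ j, 0 ≤ ε j) (hτ : ∀ j, 0 ≤ τ j) (hΘ : ∀ j, 0 ≤ Θ j) (hC'' : 0 ≤ C'') (hC₃ : 0 < C₃) (hb : 0 ≤ b)
  (hadd : ∀ j < k, ∀ (F G : Site d → Fin d → 𝔸) (z : Site d) (κ : Fin d),
    linQcov L (avgIter L W j) (F + G) ((L : ℤ) • z) κ =
      linQcov L (avgIter L W j) F ((L : ℤ) • z) κ + linQcov L (avgIter L W j) G ((L : ℤ) • z) κ)
  (hsmul : ∀ j < k, ∀ (t : ℂ) (F : Site d → Fin d → 𝔸) (z : Site d) (κ : Fin d),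
    linQcov L (avgIter L W j) (t • F) ((L : ℤ) • z) κ = t • linQcov L (avgIter L W j) F ((L : ℤ) • z) κ)
  (h139 : ∀ j < k, ∀ (G : Site d → Fin d → 𝔸) (z : Site d) (κ : Fin d),
    ‖linQcov L (avgIter L W j) G ((L : ℤ) • z) κ‖ ≤
      (1 + ε j) * avQ L (fun x κ' => ‖G x κ'‖) ((L : ℤ) • z) κ
        + τ j * (L : ℝ) * ddQ L (fun x κ' => ‖G x κ'‖) ((L : ℤ) • z) κ)
  (hstep143 : ∀ j < k,
    (1 + ε j) * Θ j * (2 * (L : ℝ) - 1) + ε j * (L : ℝ) + τ j * (L : ℝ) * (1 + 2 * d * Θ j) ≤ Θ (j + 1) * (L : ℝ))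
  (hloc : ∀ j < k, ∀ (F F' : Site d → Fin d → 𝔸) (z : Site d) (κ : Fin d),
    AgreeOn ((L : ℤ) • z) (bondHi L ((L : ℤ) • z) κ) F F' →
      Ccov L (avgIter L W j) F ((L : ℤ) • z) κ = Ccov L (avgIter L W j) F' ((L : ℤ) • z) κ)
  (h148 : ∀ j < k, ∀ (z : Site d) (κ : Fin d),
    Ineq148Printed (fun a : ↥(S1 L ((L : ℤ) • z) κ) → 𝔸 =>
      Ccov L (avgIter L W j) (insCfg (S1 L ((L : ℤ) • z) κ) a) ((L : ℤ) • z) κ) (L : ℝ) d ρ C'')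
  (hdiff : ∀ j < k, ∀ (z : Site d) (κ : Fin d) (a : ↥(S1 L ((L : ℤ) • z) κ) → 𝔸), ‖a‖ < ρ →
    DifferentiableAt ℂ (fun a : ↥(S1 L ((L : ℤ) • z) κ) → 𝔸 =>
      Ccov L (avgIter L W j) (insCfg (S1 L ((L : ℤ) • z) κ) a) ((L : ℤ) • z) κ) a)
  (B : Site d → Fin d → 𝔸)
  (h131 : ∀ j < k, ∀ (x : Site d) (κ : Fin d), ‖logCovIter L W B j x κ‖ ≤ 2 * ((L : ℝ) ^ j * b))
  (hρ : ∀ j < k, 2 * ((L : ℝ) ^ j * b) < ρ)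
  (hstep149 : ∀ j < k, (1 + ε j) * (2 * (L : ℝ) - 1) + 2 * d * τ j * (L : ℝ)
    + 2 * C'' / C₃ * (1 + 2 * d * Θ j + 2 * d * C₃ * ((L : ℝ) ^ k * b)) ≤ (L : ℝ) ^ 2)

include hL hε hτ hΘ hC'' hC₃ hb hadd hsmul h139 hstep143 hloc h148 hdiff h131 hρ hstep149 in
/-- **THE (149) INDUCTION, PER BOND, AT THE COMPLEX BACKGROUND** (pp. 40–41 rerun at `W̄ʲ = Ũ′ʲŪ₀ʲ`, p. 43): for the single-bond
direction `X·δ_b`, `b = ⟨y, y + e_μ⟩`, every `j ≤ k` and every bond `c = ⟨z, z + e_κ⟩` of the `j`-th lattice: (a) `t ↦ C_j(B +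
tXδ_b)(c)` is differentiable at `t = 0` ((137), `t ∈ ℂ`); (b) «|⟨(δ/δA)C_j(U′U₀, A), δA⟩| ≦ C₃|A|Q″_j|δA|» column-wise:
`‖dC_j(B; Xδ_b)(c)‖ ≤ C₃·(Lʲ)²b·kerQdd(c, b)·‖X‖`.  Base `j = 0`: `C_0 = 0`.  Step = (153): the chain rule through the variables
of `C(W̄ʲ, ·, c)` at the point `Q_j(W, ηB)|_S` of size `≤ 2Lʲb < ρ` (`h131`, `hρ`), (148) there (`h148`) against `Q″` of the inner
variation `L^{−1}Q_j(W)δA + L^{−1}⟨δC_j/δA, δA⟩` bounded by (143)ⱼ (file 2, cumulative `Θ_j`) and (149)ⱼ through «Q″Q_j ≦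
Q″_{j+1}», (142), and the term `Q(W̄ʲ)⟨δC_j/δA, δA⟩` by the three-term (139)ⱼ (`h139`) through «QQ″_j ≦ (2−L⁻¹)Q″_{j+1}», (142);
the arithmetic closes by (155)ⱼ (`hstep149`). [cite: Balaban1985Averaging, (149)–(155) pp.40–41, Proposition 7 p.43] -/
theorem ineq149_cplx (y : Site d) (μ : Fin d) (X : 𝔸) :
    ∀ j ≤ k, ∀ (z : Site d) (κ : Fin d),
      HasLineDerivAt ℂ (fun B' => CCovIter L W B' j z κ) (dCov L W B (bump y μ X) j z κ) B (bump y μ X) ∧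
      ‖dCov L W B (bump y μ X) j z κ‖ ≤ C₃ * (((L : ℝ) ^ j) ^ 2 * b) * kerQdd L j z κ y μ * ‖X‖ := by
  classical
  have hL1 : 1 ≤ L := le_trans (by norm_num) hL
  have hLr : (2 : ℝ) ≤ L := by exact_mod_cast hL
  have hL1r : (1 : ℝ) ≤ L := by linarith
  have hLpos : (0 : ℝ) < L := by linarith
  set D := bump y μ X with hD
  intro j
  induction j with
  | zero =>
    intro _ z κ
    have hd0 : dCov L W B D 0 z κ = 0 := by
      simp [dCov, lineDeriv, CCovIter]
    refine ⟨?_, ?_⟩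
    · rw [hd0]
      show HasDerivAt (fun t : ℂ => CCovIter L W (B + t • D) 0 z κ) 0 0
      simp only [CCovIter_zero]
      exact hasDerivAt_const 0 0
    · rw [hd0, norm_zero]
      have := kerQdd_nonneg L 0 z κ y μ
      positivity
  | succ j ihj =>
    intro hjk z κ
    have hj : j < k := Nat.lt_of_succ_le hjk
    have ih := ihj hj.le
    -- the data of the step
    set q : Site d := (L : ℤ) • z with hq
    set S := S1 L q κ with hS
    set V := avgIter L W j with hV
    set ρ0 : S → 𝔸 := restr S (logCovIter L W B j) with hρ0
    set f : (S → 𝔸) → 𝔸 := fun a => Ccov L V (insCfg S a) q κ with hf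
    set E : Site d → Fin d → 𝔸 := fun x μ' => dCov L W B D j x μ' + linCovIter L W D j x μ' with hE
    set K : ℝ := C₃ * (((L : ℝ) ^ j) ^ 2 * b) with hK
    have hK0 : 0 ≤ K := by positivity
    set Wt := kerQdd L (j + 1) z κ y μ with hWt
    have hW0 : 0 ≤ Wt := kerQdd_nonneg L (j + 1) z κ y μ
    have hεj := hε j
    have hτj := hτ j
    have hΘj := hΘ j
    -- the size of the base point (131) and the domain of (148)
    have htj : 0 ≤ (L : ℝ) ^ j * b := by positivity
    have hρ0n : ‖ρ0‖ ≤ 2 * ((L : ℝ) ^ j * b) :=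
      (pi_norm_le_iff_of_nonneg (by positivity)).2 fun s' => h131 j hj _ _
    have hρ0lt : ‖ρ0‖ < ρ := hρ0n.trans_lt (hρ j hj)
    have hfan : DifferentiableAt ℂ f ρ0 := hdiff j hj z κ ρ0 hρ0lt
    -- the two-term form of (139)ⱼ for the one-step calculus of `B7Prop5GeneralLinear` §2
    have h139' : ∀ G : Site d → Fin d → 𝔸, ‖linQcov L V G q κ‖ ≤
        avQ L (fun x κ' => ‖G x κ'‖) q κ + (ε j * (L : ℝ) ^ d + τ j * (L : ℝ)) * ddQ L (fun x κ' => ‖G x κ'‖) q κ :=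
      h139_two_of_three L hL1 V q κ hεj fun G => h139 j hj G z κ
    have he₁ : 0 ≤ ε j * (L : ℝ) ^ d + τ j * (L : ℝ) := by positivity
    -- the line through the variables of `C(W̄ʲ, ·, c)`
    have hlog : ∀ x μ', HasDerivAt (fun t : ℂ => logCovIter L W (B + t • D) j x μ') (E x μ') 0 := by
      intro x μ'
      have h1 : HasDerivAt (fun t : ℂ => CCovIter L W (B + t • D) j x μ') (dCov L W B D j x μ') 0 := (ih x μ').1
      have h2 := hasDerivAt_linCovIter_line L W k hadd hsmul B D hj.le x μ'
      refine (h1.add h2).congr_of_eventuallyEq (Filter.Eventually.of_forall fun t => ?_)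
      simp [CCovIter]
    have hρ' : HasDerivAt (fun t : ℂ => restr S (logCovIter L W (B + t • D) j)) (restr S E) 0 :=
      hasDerivAt_pi.2 fun s' => hlog s'.1.1 s'.1.2
    have hρfun0 : restr S (logCovIter L W (B + (0 : ℂ) • D) j) = ρ0 := by rw [zero_smul, add_zero]
    have hfan0 : DifferentiableAt ℂ f (restr S (logCovIter L W (B + (0 : ℂ) • D) j)) := by rw [hρfun0]; exact hfan
    have hcomp : HasDerivAt (fun t : ℂ => f (restr S (logCovIter L W (B + t • D) j))) (fderiv ℂ f ρ0 (restr S E)) 0 := by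
      have := hfan0.hasFDerivAt.comp_hasDerivAt (0 : ℂ) hρ'
      rw [hρfun0] at this
      exact this
    have hone : HasDerivAt (fun t : ℂ => Ccov L V (logCovIter L W (B + t • D) j) q κ) (fderiv ℂ f ρ0 (restr S E)) 0 := by
      refine hcomp.congr_of_eventuallyEq (Filter.Eventually.of_forall fun t => ?_)
      exact hloc j hj _ _ z κ (agreeOn_insCfg_restr q (bondHi L q κ) _)
    have hlinC : HasDerivAt (fun t : ℂ => linQcov L V (fun x μ' => CCovIter L W (B + t • D) j x μ') q κ)
        (linQcov L V (fun x μ' => dCov L W B D j x μ') q κ) 0 :=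
      hasDerivAt_linQcov_family L V z κ (fun F G => hadd j hj F G z κ) (fun t F => hsmul j hj t F z κ)
        h139' he₁ hL1 (Φ := fun t x μ' => CCovIter L W (B + t • D) j x μ') fun x μ' => (ih x μ').1
    have htot : HasDerivAt (fun t : ℂ => CCovIter L W (B + t • D) (j + 1) z κ)
        (fderiv ℂ f ρ0 (restr S E) + linQcov L V (fun x μ' => dCov L W B D j x μ') q κ) 0 := by
      refine (hone.add hlinC).congr_of_eventuallyEq (Filter.Eventually.of_forall fun t => ?_)
      exact CCovIter_succ L W _ j z κ fun F G => hadd j hj F G z κ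
    have hval : dCov L W B D (j + 1) z κ =
        fderiv ℂ f ρ0 (restr S E) + linQcov L V (fun x μ' => dCov L W B D j x μ') q κ := htot.deriv
    -- sizes of the inner variation: (149)ⱼ and (143)ⱼ per bond
    set C₁ : ℝ := (K + Θ j * (L : ℝ) ^ j) * ‖X‖ with hC₁
    have hC₁0 : 0 ≤ C₁ := by positivity
    have hdCb : ∀ x μ', ‖dCov L W B D j x μ'‖ ≤ (K * ‖X‖) * kerQdd L j x μ' y μ := fun x μ' => by
      have := (ih x μ').2; rw [hK]; linarith [this]
    have hEb : ∀ x μ', ‖E x μ'‖ ≤ ‖X‖ * kerQ L j x μ' y μ + C₁ * kerQdd L j x μ' y μ := by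
      intro x μ'
      have h1 := hdCb x μ'
      have h2 := ineq143_cplx L hL W k hε hτ hΘ h139 hstep143 y μ X j hj.le x μ'
      calc ‖E x μ'‖ ≤ ‖dCov L W B D j x μ'‖ + ‖linCovIter L W D j x μ'‖ := norm_add_le _ _
        _ ≤ (K * ‖X‖) * kerQdd L j x μ' y μ
              + (kerQ L j x μ' y μ + Θ j * (L : ℝ) ^ j * kerQdd L j x μ' y μ) * ‖X‖ := add_le_add h1 h2
        _ = ‖X‖ * kerQ L j x μ' y μ + C₁ * kerQdd L j x μ' y μ := by rw [hC₁]; ring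
    -- (148) at the base point against `Q″|E|`
    have h148' : ‖fderiv ℂ f ρ0 (restr S E)‖ ≤ C'' * ‖ρ0‖ * ddQ L (fun x μ' => ‖E x μ'‖) q κ := by
      rw [← dPair_eq_fderiv hfan, ← Qpp_restr_eq_ddQ]
      exact h148 j hj z κ ρ0 hρ0lt (restr S E)
    have hddE : ddQ L (fun x μ' => ‖E x μ'‖) q κ ≤ ‖X‖ * ((L : ℝ) ^ j * Wt) + C₁ * (2 * d * Wt) := by
      calc ddQ L (fun x μ' => ‖E x μ'‖) q κ
          ≤ ddQ L (fun x μ' => ‖X‖ * kerQ L j x μ' y μ + C₁ * kerQdd L j x μ' y μ) q κ := ddQ_mono L hEb _ _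
        _ = ‖X‖ * ddQ L (fun x μ' => kerQ L j x μ' y μ) q κ + C₁ * ddQ L (fun x μ' => kerQdd L j x μ' y μ) q κ := by
            rw [ddQ_add, ddQ_smul, ddQ_smul]
        _ ≤ _ := add_le_add (mul_le_mul_of_nonneg_left (ddQ_kerQ_le L hL1 j z κ y μ) (norm_nonneg X))
              (mul_le_mul_of_nonneg_left (ddQ_kerQdd_le L hL1 j z κ y μ) hC₁0)
    have hT2 : ‖fderiv ℂ f ρ0 (restr S E)‖ ≤
        C'' * (2 * ((L : ℝ) ^ j * b)) * (‖X‖ * ((L : ℝ) ^ j * Wt) + C₁ * (2 * d * Wt)) := by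
      have hdd0 : 0 ≤ ddQ L (fun x μ' => ‖E x μ'‖) q κ := ddQ_nonneg L (fun _ _ => norm_nonneg _) _ _
      calc ‖fderiv ℂ f ρ0 (restr S E)‖ ≤ C'' * ‖ρ0‖ * ddQ L (fun x μ' => ‖E x μ'‖) q κ := h148'
        _ ≤ C'' * (2 * ((L : ℝ) ^ j * b)) * ddQ L (fun x μ' => ‖E x μ'‖) q κ :=
            mul_le_mul_of_nonneg_right (mul_le_mul_of_nonneg_left hρ0n hC'') hdd0
        _ ≤ _ := mul_le_mul_of_nonneg_left hddE (by positivity)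
    -- the term `Q(W̄ʲ)⟨δC_j/δA, δA⟩` by the three-term (139)ⱼ
    have hT1 : ‖linQcov L V (fun x μ' => dCov L W B D j x μ') q κ‖ ≤
        (1 + ε j) * ((K * ‖X‖) * ((2 * (L : ℝ) - 1) * Wt)) + τ j * (L : ℝ) * ((K * ‖X‖) * (2 * d * Wt)) := by
      have hKX : 0 ≤ K * ‖X‖ := by positivity
      have h1ε : 0 ≤ 1 + ε j := by linarith
      have hav : avQ L (fun x μ' => ‖dCov L W B D j x μ'‖) q κ ≤ (K * ‖X‖) * ((2 * (L : ℝ) - 1) * Wt) := by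
        calc avQ L (fun x μ' => ‖dCov L W B D j x μ'‖) q κ
            ≤ avQ L (fun x μ' => (K * ‖X‖) * kerQdd L j x μ' y μ) q κ := avQ_mono L hdCb _ _
          _ = (K * ‖X‖) * avQ L (fun x μ' => kerQdd L j x μ' y μ) q κ := by rw [avQ_smul]
          _ ≤ _ := mul_le_mul_of_nonneg_left (avQ_kerQdd_le L hL1 j z κ y μ) hKX
      have hdd : ddQ L (fun x μ' => ‖dCov L W B D j x μ'‖) q κ ≤ (K * ‖X‖) * (2 * d * Wt) := by
        calc ddQ L (fun x μ' => ‖dCov L W B D j x μ'‖) q κ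
            ≤ ddQ L (fun x μ' => (K * ‖X‖) * kerQdd L j x μ' y μ) q κ := ddQ_mono L hdCb _ _
          _ = (K * ‖X‖) * ddQ L (fun x μ' => kerQdd L j x μ' y μ) q κ := by rw [ddQ_smul]
          _ ≤ _ := mul_le_mul_of_nonneg_left (ddQ_kerQdd_le L hL1 j z κ y μ) hKX
      exact (h139 j hj _ z κ).trans (add_le_add (mul_le_mul_of_nonneg_left hav h1ε)
        (mul_le_mul_of_nonneg_left hdd (by positivity)))
    -- the closing arithmetic (154)–(155)
    have htk : (L : ℝ) ^ j * b ≤ (L : ℝ) ^ k * b :=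
      mul_le_mul_of_nonneg_right (pow_le_pow_right₀ hL1r hj.le) hb
    have harith := ineq155_cplx_arith (d := (d : ℝ)) (Nat.cast_nonneg d) hC'' hC₃ htk (hstep149 j hj)
    refine ⟨hval ▸ htot, ?_⟩
    rw [hval]
    refine (norm_add_le _ _).trans ?_
    refine (add_le_add hT2 hT1).trans ?_
    -- everything is `Wt·‖X‖·(Lʲ)²b·[…]`; compare the bracket with `C₃L²`
    have hXW : 0 ≤ ‖X‖ * Wt * (((L : ℝ) ^ j) ^ 2 * b) := by positivity
    have key := mul_le_mul_of_nonneg_left harith (mul_nonneg hXW hC₃.le)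
    have hC₃ne : C₃ ≠ 0 := hC₃.ne'
    have expand : C'' * (2 * ((L : ℝ) ^ j * b)) * (‖X‖ * ((L : ℝ) ^ j * Wt) + C₁ * (2 * d * Wt))
        + ((1 + ε j) * ((K * ‖X‖) * ((2 * (L : ℝ) - 1) * Wt)) + τ j * (L : ℝ) * ((K * ‖X‖) * (2 * d * Wt)))
        = ‖X‖ * Wt * (((L : ℝ) ^ j) ^ 2 * b) * C₃
          * ((1 + ε j) * (2 * L - 1) + 2 * d * τ j * L
              + 2 * C'' / C₃ * (1 + 2 * d * Θ j + 2 * d * C₃ * ((L : ℝ) ^ j * b))) := by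
      rw [hC₁, hK]
      field_simp
      ring
    rw [expand]
    refine key.trans (le_of_eq ?_)
    ring

include hL hε hτ hΘ hC'' hC₃ hb hadd hsmul h139 hstep143 hloc h148 hdiff h131 hρ hstep149 in
/-- **(157) PER BOND AT THE COMPLEX BACKGROUND, k-UNIFORM** «|(δ/δA_b)C_k(U′U₀, A, c)| ≦ C₃|A|» («uniformly in A′» once the
sequences are): for every `j ≤ k`, `‖dC_j(B; Xδ_b)(c)‖ ≤ C₃·(Lʲ)²·L^{−jd}·b·‖X‖` (at `j = k`, `B = ηA`: `C₃|A|·η^d·‖X‖`, i.e. (157)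
with (138)'s `η^{−d}`), and the derivative VANISHES unless `b ⊂ Bʲ(c₋) ∪ Bʲ(c₊)` (locality). [cite: Balaban1985Averaging, Prop. 5 (157) p.42, (149) p.40, Proposition 7 p.43] -/
theorem prop5_cplx_157 (y : Site d) (μ : Fin d) (X : 𝔸) {j : ℕ} (hj : j ≤ k) (z : Site d) (κ : Fin d) :
    HasLineDerivAt ℂ (fun B' => CCovIter L W B' j z κ) (dCov L W B (bump y μ X) j z κ) B (bump y μ X) ∧
      ‖dCov L W B (bump y μ X) j z κ‖ ≤ C₃ * ((L : ℝ) ^ j) ^ 2 * (((L : ℝ) ^ j) ^ d)⁻¹ * b * ‖X‖ ∧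
      (¬ BondIn (loK L j z) (bondHiK L j z κ) y μ → dCov L W B (bump y μ X) j z κ = 0) := by
  obtain ⟨h1, h2⟩ := ineq149_cplx L hL W k hε hτ hΘ hC'' hC₃ hb hadd hsmul h139 hstep143 hloc h148 hdiff B h131 hρ
    hstep149 y μ X j hj z κ
  refine ⟨h1, h2.trans ?_, fun hnot => ?_⟩
  · have h3 := kerQdd_le L j z κ y μ
    have : C₃ * (((L : ℝ) ^ j) ^ 2 * b) * kerQdd L j z κ y μ * ‖X‖
        ≤ C₃ * (((L : ℝ) ^ j) ^ 2 * b) * (((L : ℝ) ^ j) ^ d)⁻¹ * ‖X‖ :=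
      mul_le_mul_of_nonneg_right (mul_le_mul_of_nonneg_left h3 (by positivity)) (norm_nonneg X)
    refine this.trans (le_of_eq ?_)
    ring
  · rw [kerQdd_of_not_bondIn hnot, mul_zero, zero_mul] at h2
    exact norm_le_zero_iff.1 h2

include hL hε hτ hΘ hC'' hC₃ hb hadd hsmul h139 hstep143 hloc h148 hdiff h131 hρ hstep149 in
/-- **(156) PER BOND AT THE COMPLEX BACKGROUND, k-UNIFORM** «|(δ/δA_b)Q_k(U′U₀, ηA, c)| ≦ 1 + 2C′₁α₀ + C₃|A|» with «2C′₁α₀ ↦ Θ_j»: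
`B′ ↦ Q_j(W, ηB′)(c)` (the composite (127), `logCovIter`) is differentiable at `B` in the direction `X·δ_b` with derivative
`dC_j(B; Xδ_b)(c) + LʲηQ_j(W)(Xδ_b)(c)`, of norm `≤ ((1 + Θ_j)·Lʲ + C₃(Lʲ)²b)·L^{−jd}·‖X‖` — (147) + (157) via (134).
[cite: Balaban1985Averaging, Prop. 5 (156) p.42, (134) p.38, (147) p.40, Proposition 7 p.43] -/
theorem prop5_cplx_156 (y : Site d) (μ : Fin d) (X : 𝔸) {j : ℕ} (hj : j ≤ k) (z : Site d) (κ : Fin d) :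
    HasLineDerivAt ℂ (fun B' => logCovIter L W B' j z κ)
        (dCov L W B (bump y μ X) j z κ + linCovIter L W (bump y μ X) j z κ) B (bump y μ X) ∧
      ‖dCov L W B (bump y μ X) j z κ + linCovIter L W (bump y μ X) j z κ‖ ≤
        ((1 + Θ j) * (L : ℝ) ^ j + C₃ * ((L : ℝ) ^ j) ^ 2 * b) * (((L : ℝ) ^ j) ^ d)⁻¹ * ‖X‖ := by
  obtain ⟨h1, h2, -⟩ := prop5_cplx_157 L hL W k hε hτ hΘ hC'' hC₃ hb hadd hsmul h139 hstep143 hloc h148 hdiff B h131 hρ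
    hstep149 y μ X hj z κ
  have h3 := ineq147_cplx L hL W k hε hτ hΘ h139 hstep143 y μ X hj z κ
  refine ⟨?_, (norm_add_le _ _).trans ?_⟩
  · have h1' : HasDerivAt (fun t : ℂ => CCovIter L W (B + t • bump y μ X) j z κ) (dCov L W B (bump y μ X) j z κ) 0 := h1
    have h12 := h1'.add (hasDerivAt_linCovIter_line L W k hadd hsmul B (bump y μ X) hj z κ)
    show HasDerivAt (fun t : ℂ => logCovIter L W (B + t • bump y μ X) j z κ) _ 0
    refine h12.congr_of_eventuallyEq (Filter.Eventually.of_forall fun t => ?_)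
    simp [CCovIter]
  · refine (add_le_add h2 h3).trans (le_of_eq ?_)
    ring

end Levels

end Literature.MathematicalPhysics.QuantumFieldTheory.Balaban1983to89.B7Prop5CplxInduction

end
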